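import Literature.Computability.AlgebraicComplexity.EsymmFromProductBits
import Literature.Computability.AlgebraicComplexity.RealTauConjectureDefinable
import Literature.Computability.Complexity.CHBitsFromResidues
import Literature.Computability.Complexity.CHIterProd
import HarnessLib

/-!
# Discharge of Bürgisser's Cor. 3.9 and of Tavenas' Lemma 3.16

This file closes the chain

* Bürgisser, ECCC TR06-113 (2006) = Comput. Complexity 18 (2009), **Cor. 3.9**: the elementary
  symmetric functions `(σ_k(1, …, n))_{n, k ≤ n}` are definable in `CH`
  (`Burgisser2009_esymm_chDefinable_holds`);
* hence (PochhammerWilkinsonDefinable, Bürgisser §3 / Tavenas Lemme 3.16 proof) the coefficients of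
  the Pochhammer–Wilkinson polynomials `PW_n = ∏_{i=1}^{2ⁿ} (X + i)` are definable in `CH`
  (`Burgisser2009_pochhammerWilkinson_coeff_chDefinable_holds`);
* hence **Tavenas, thèse (2014), Lemme 3.16**: `(PW_{2ⁿ})` is `CH/poly`-definable
  (`Tavenas2014_pochhammerWilkinson_definable_holds`).

The one remaining input, the bit language of Bürgisser's padded product
`d(n) = ∏_{k=1}^{n} (2^{n²+1} + k)` (`EsymmFromProductBits.cor39Prod`), is obtained here
(`cor39Prod_bits_mem_CH`) from the toolkit: the residues `d(n) mod m` modulo short primes `m` are an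
iterated product modulo `m` of the `P`-computable residues `(2^{n²+1} mod m + k) mod m` of the (long)
factors (`Complexity.iterProdModGraph_mem_CH`, Bürgisser Thm. 3.7 (1) in residue form), and the bits
follow from the residues by `Complexity.bitsOfResidues_mem_CH` (Bürgisser Thm. 3.4 (⇐),
Hesse–Allender–Barrington Thm. 4.1).

## References

* S. Tavenas, *Bornes inférieures et supérieures dans les circuits arithmétiques*, thèse, ENS Lyon
  (2014), Lemme 3.16, p. 44.
* P. Bürgisser, *On defining integers and proving arithmetic circuit lower bounds*, Comput.
  Complexity 18 (2009) 81–103 = ECCC TR06-113, Thm. 3.4, Thm. 3.7, Cor. 3.9.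
* W. Hesse, E. Allender, D. A. M. Barrington, JCSS 65 (2002), Thm. 4.1.
-/

open Computability Polynomial Finset
open Literature.Computability.Complexity Literature.Computability.Complexity.Classes Brick PRelSigma TTClosure PPSharpP
  ThresholdPP Plumb

namespace Literature.Computability.AlgebraicComplexity

/-! ### The residues of the factors `2^{n²+1} + k` modulo a short modulus -/

/-- **The residue family**: on words `x = ⟨⟨u, m⟩, bin k⟩`, the value
`((2^{N} mod val m) + (k+1)) mod val m` (with the brick convention `2^N mod m = 0` for `val m ≤ 1`)
for `k < val u`, and `1 mod val m` beyond, `N = (val u)² + 1`; its graph is in `CH` (all `FP`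
numerals: `modExpFn`, `addFn`, `prodFn`, `remFn`). [cite: Burgisser2006, Cor. 3.9] -/
theorem cor39ResGraph_mem_CH :
    {z | (if bitsToNat (sndP (fstP z)) < bitsToNat (fstP (fstP (fstP z))) then
          ((if bitsToNat (sndP (fstP (fstP z))) ≤ 1 then 0
            else 2 ^ (bitsToNat (fstP (fstP (fstP z))) * bitsToNat (fstP (fstP (fstP z))) + 1) % bitsToNat (sndP (fstP (fstP z)))) +
            (bitsToNat (sndP (fstP z)) + 1)) % bitsToNat (sndP (fstP (fstP z)))
        else 1 % bitsToNat (sndP (fstP (fstP z)))) = bitsToNat (sndP z)} ∈ CH := by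
  -- the guard `k < n`
  have hC : ({x | bitsToNat (sndP x) < bitsToNat (fstP (fstP x))} : Language Bool) ∈ CH :=
    P_subset_CH (mem_P_of_iff (preimage_mem_P ltVal_mem_P (pairFn_mem_FP sndP_mem_FP (comp_mem_FP fstP_mem_FP fstP_mem_FP))) _
      fun x => by
        change _ ↔ bitsToNat (fstP (pairFn sndP (fstP ∘ fstP) x)) < bitsToNat (sndP (pairFn sndP (fstP ∘ fstP) x))
        rw [pairFn_apply, fstP_boolPair, sndP_boolPair]; rfl)
  -- the `FP` numerals
  have hNSQ : addFn ∘ pairFn (prodFn ∘ pairFn (fstP ∘ fstP) (fstP ∘ fstP)) (fun _ => encodeNat 1) ∈ FP :=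
    comp_mem_FP addFn_mem_FP (pairFn_mem_FP (comp_mem_FP prodFn_mem_FP (pairFn_mem_FP (comp_mem_FP fstP_mem_FP fstP_mem_FP)
      (comp_mem_FP fstP_mem_FP fstP_mem_FP))) (const_mem_FP _))
  have hG₁ : remFn ∘ pairFn (addFn ∘ pairFn (modExpFn ∘ pairFn (fun _ => encodeNat 2) (pairFn
      (addFn ∘ pairFn (prodFn ∘ pairFn (fstP ∘ fstP) (fstP ∘ fstP)) (fun _ => encodeNat 1)) (sndP ∘ fstP)))
      (addFn ∘ pairFn sndP (fun _ => encodeNat 1))) (sndP ∘ fstP) ∈ FP :=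
    comp_mem_FP remFn_mem_FP (pairFn_mem_FP (comp_mem_FP addFn_mem_FP (pairFn_mem_FP
      (comp_mem_FP modExpFn_mem_FP (pairFn_mem_FP (const_mem_FP _) (pairFn_mem_FP hNSQ (comp_mem_FP sndP_mem_FP fstP_mem_FP))))
      (comp_mem_FP addFn_mem_FP (pairFn_mem_FP sndP_mem_FP (const_mem_FP _))))) (comp_mem_FP sndP_mem_FP fstP_mem_FP))
  have hG₂ : remFn ∘ pairFn (fun _ => encodeNat 1) (sndP ∘ fstP) ∈ FP :=
    comp_mem_FP remFn_mem_FP (pairFn_mem_FP (const_mem_FP _) (comp_mem_FP sndP_mem_FP fstP_mem_FP))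
  have hf := graphFP_mem_CH hG₁
  have hg := graphFP_mem_CH hG₂
  refine mem_CH_of_iff (iteGraph_mem_CH' hC
    (f := fun x => bitsToNat ((remFn ∘ pairFn (addFn ∘ pairFn (modExpFn ∘ pairFn (fun _ => encodeNat 2) (pairFn
      (addFn ∘ pairFn (prodFn ∘ pairFn (fstP ∘ fstP) (fstP ∘ fstP)) (fun _ => encodeNat 1)) (sndP ∘ fstP)))
      (addFn ∘ pairFn sndP (fun _ => encodeNat 1))) (sndP ∘ fstP)) x))
    (g := fun x => bitsToNat ((remFn ∘ pairFn (fun _ => encodeNat 1) (sndP ∘ fstP)) x)) hf hg) _ fun z => ?_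
  change (if _ then _ else _) = bitsToNat (sndP z) ↔ (if _ then _ else _) = bitsToNat (sndP z)
  simp only [Function.comp_apply, pairFn_apply, remFn_boolPair, addFn_boolPair, prodFn_boolPair, bitsToNat_encodeNat,
    bitsToNat_modExpFn, fstP_boolPair, sndP_boolPair]

/-- The residue family is below `2^{|x|+1}`. [folklore] -/
theorem cor39Res_lt_two_pow (x : List Bool) :
    (if bitsToNat (sndP x) < bitsToNat (fstP (fstP x)) then
          ((if bitsToNat (sndP (fstP x)) ≤ 1 then 0
            else 2 ^ (bitsToNat (fstP (fstP x)) * bitsToNat (fstP (fstP x)) + 1) % bitsToNat (sndP (fstP x))) +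
            (bitsToNat (sndP x) + 1)) % bitsToNat (sndP (fstP x))
        else 1 % bitsToNat (sndP (fstP x))) < 2 ^ (X + 1 : Polynomial ℕ).eval x.length := by
  rw [eval_add, eval_X, eval_one]
  have hl := length_fstF_sndF_le x
  change 2 * (fstP x).length + (sndP x).length ≤ _ at hl
  have hl' := length_fstF_sndF_le (fstP x)
  change 2 * (fstP (fstP x)).length + (sndP (fstP x)).length ≤ _ at hl'
  have hk : bitsToNat (sndP x) + 1 ≤ 2 ^ x.length :=
    (bitsToNat_lt _).trans_le (Nat.pow_le_pow_right (by norm_num) (by omega))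
  have hm : bitsToNat (sndP (fstP x)) < 2 ^ x.length :=
    (bitsToNat_lt _).trans_le (Nat.pow_le_pow_right (by norm_num) (by omega))
  rw [show (2 : ℕ) ^ (x.length + 1) = 2 ^ x.length * 2 from pow_succ 2 x.length]
  split_ifs with h1 h2
  · -- `val m ≤ 1`
    rcases Nat.eq_zero_or_pos (bitsToNat (sndP (fstP x))) with h0 | hpos
    · rw [h0, Nat.mod_zero]; omega
    · exact (Nat.mod_lt _ hpos).trans (by omega)
  · exact (Nat.mod_lt _ (by omega)).trans (by omega)
  · rcases Nat.eq_zero_or_pos (bitsToNat (sndP (fstP x))) with h0 | hpos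
    · rw [h0, Nat.mod_zero]; omega
    · exact (Nat.mod_lt _ hpos).trans (by omega)

/-- The residue family agrees with the factor family `cor39Factor` modulo a prime. [folklore] -/
theorem cor39Res_mod_eq (u μ : List Bool) (k : ℕ) (hμ : (bitsToNat μ).Prime) :
    (if k < bitsToNat u then
          ((if bitsToNat μ ≤ 1 then 0 else 2 ^ (bitsToNat u * bitsToNat u + 1) % bitsToNat μ) + (k + 1)) % bitsToNat μ
        else 1 % bitsToNat μ) % bitsToNat μ = cor39Factor (boolPair u (encodeNat k)) % bitsToNat μ := by
  have hμ1 : ¬ bitsToNat μ ≤ 1 := by have := hμ.two_le; omega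
  rw [cor39Factor_boolPair, if_neg hμ1, cor39N, pow_two]
  split_ifs
  · rw [Nat.mod_mod, Nat.mod_add_mod]
  · rw [Nat.mod_mod]

/-! ### The residues and the bits of `d(n)` -/

/-- **The residues of `d(n)` modulo short primes have a `CH` graph**: on `⟨u, μ⟩`, for prime
`val μ`, `d(val u) mod val μ` is the iterated product modulo `μ` of the residue family
(Bürgisser Thm. 3.7 (1), residue form). [cite: Burgisser2006, Theorem 3.7] -/
theorem cor39ProdResGraph_mem_CH :
    {z | (if (bitsToNat (sndP (fstP z))).Prime then cor39Prod (bitsToNat (fstP (fstP z))) % bitsToNat (sndP (fstP z)) else 0) =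
      bitsToNat (sndP z)} ∈ CH := by
  obtain ⟨A, hAg, hAb, hA⟩ : ∃ A : List Bool → ℕ, {z | A (fstP z) = bitsToNat (sndP z)} ∈ CH ∧
      (∀ x, A x < 2 ^ (X + 1 : Polynomial ℕ).eval x.length) ∧ ∀ x, A x =
      if bitsToNat (sndP x) < bitsToNat (fstP (fstP x)) then
        ((if bitsToNat (sndP (fstP x)) ≤ 1 then 0
          else 2 ^ (bitsToNat (fstP (fstP x)) * bitsToNat (fstP (fstP x)) + 1) % bitsToNat (sndP (fstP x))) +
          (bitsToNat (sndP x) + 1)) % bitsToNat (sndP (fstP x))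
      else 1 % bitsToNat (sndP (fstP x)) := ⟨_, cor39ResGraph_mem_CH, cor39Res_lt_two_pow, fun x => rfl⟩
  have hIP := iterProdModGraph_mem_CH X hAg hAb
  -- the diagonal `⟨⟨u, μ⟩, μ⟩`
  refine mem_CH_of_iff (graph_comp_FP_mem_CH
    (f := fun y => if (bitsToNat (sndP y)).Prime then
      (∏ k ∈ range (2 ^ (X : Polynomial ℕ).eval (fstP y).length), A (boolPair (fstP y) (encodeNat k))) % bitsToNat (sndP y) else 0)
    hIP (pairFn_mem_FP OracleCompose.id_mem_FP sndP_mem_FP)) _ fun z => ?_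
  change (if _ then _ else 0) = bitsToNat (sndP z) ↔
    (if (bitsToNat (sndP (pairFn id sndP (fstP z)))).Prime then
      (∏ k ∈ range (2 ^ (X : Polynomial ℕ).eval (fstP (pairFn id sndP (fstP z))).length),
        A (boolPair (fstP (pairFn id sndP (fstP z))) (encodeNat k))) % bitsToNat (sndP (pairFn id sndP (fstP z))) else 0) =
      bitsToNat (sndP z)
  simp only [pairFn_apply, id, fstP_boolPair, sndP_boolPair, eval_X]
  by_cases hpr : (bitsToNat (sndP (fstP z))).Prime
  · have hprod : ∏ k ∈ range (2 ^ (fstP z).length), A (boolPair (fstP z) (encodeNat k)) % bitsToNat (sndP (fstP z)) =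
        ∏ k ∈ range (2 ^ (fstP z).length), cor39Factor (boolPair (fstP (fstP z)) (encodeNat k)) % bitsToNat (sndP (fstP z)) :=
      Finset.prod_congr rfl fun k _ => by
        rw [hA]
        simp only [fstP_boolPair, sndP_boolPair, bitsToNat_encodeNat]
        exact cor39Res_mod_eq _ _ k hpr
    rw [if_pos hpr, if_pos hpr, Finset.prod_nat_mod, hprod, ← Finset.prod_nat_mod,
      prod_cor39Factor _ ((bitsToNat_lt _).le.trans (Nat.pow_le_pow_right (by norm_num) (length_fstP_le _)))]
  · rw [if_neg hpr, if_neg hpr]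

/-- `d(n) < 2^{(N+1) n + 1}`. [folklore] -/
theorem cor39Prod_lt_two_pow (n : ℕ) : cor39Prod n < 2 ^ ((cor39N n + 1) * n + 1) := by
  have h1 : cor39Prod n ≤ (2 ^ (cor39N n + 1)) ^ n := by
    have h := Finset.prod_le_pow_card (range n) (fun k => 2 ^ cor39N n + (k + 1)) (2 ^ (cor39N n + 1)) fun k hk => by
      have := lt_two_pow_cor39N n
      have hk' := Finset.mem_range.1 hk
      rw [pow_succ]; omega
    rwa [Finset.card_range] at h
  rw [← pow_mul] at h1
  exact h1.trans_lt (Nat.pow_lt_pow_right (by norm_num) (Nat.lt_succ_self _))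

/-- `d(val w) < 2^{2^{3|w|+2}}`. [folklore] -/
theorem cor39Prod_val_lt (w : List Bool) : cor39Prod (bitsToNat w) < 2 ^ 2 ^ (3 * X + 2 : Polynomial ℕ).eval w.length := by
  refine (cor39Prod_lt_two_pow _).trans_le (Nat.pow_le_pow_right (by norm_num) ?_)
  simp only [eval_add, eval_mul, eval_ofNat, eval_X]
  have hn : bitsToNat w + 1 ≤ 2 ^ w.length := bitsToNat_lt w
  have h3 : (bitsToNat w + 1) ^ 3 ≤ (2 ^ w.length) ^ 3 := Nat.pow_le_pow_left hn 3
  have h4 : (2 : ℕ) ^ (3 * w.length + 2) = (2 ^ w.length) ^ 3 * 4 := by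
    rw [pow_add, pow_mul']; norm_num
  rw [cor39N, h4]
  have h5 : (bitsToNat w ^ 2 + 1 + 1) * bitsToNat w + 1 ≤ (bitsToNat w + 1) ^ 3 := by
    nlinarith [sq_nonneg (bitsToNat w)]
  calc (bitsToNat w ^ 2 + 1 + 1) * bitsToNat w + 1 ≤ (bitsToNat w + 1) ^ 3 := h5
    _ ≤ (2 ^ w.length) ^ 3 := h3
    _ ≤ (2 ^ w.length) ^ 3 * 4 := Nat.le_mul_of_pos_right _ (by norm_num)

/-- **The bits of `d(n)` are in `CH`** (Bürgisser Thm. 3.4 (⇐) applied to the residues of `d`):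
`{⟨u, s⟩ | bit (val s) of d(val u) is 1} ∈ CH`. [cite: Burgisser2006, Cor. 3.9] -/
theorem cor39Prod_bits_mem_CH :
    ({z | (cor39Prod (bitsToNat (fstP z))).testBit (bitsToNat (sndP z)) = true} : Language Bool) ∈ CH := by
  obtain ⟨F, hFg, hF⟩ : ∃ F : List Bool → ℕ, {z | F (fstP z) = bitsToNat (sndP z)} ∈ CH ∧ ∀ y, F y =
      if (bitsToNat (sndP y)).Prime then cor39Prod (bitsToNat (fstP y)) % bitsToNat (sndP y) else 0 :=
    ⟨_, cor39ProdResGraph_mem_CH, fun y => rfl⟩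
  have hFb : ∀ y, F y < 2 ^ (X : Polynomial ℕ).eval y.length := fun y => by
    rw [hF, eval_X]
    split_ifs with h
    · have hl := length_fstF_sndF_le y
      change 2 * (fstP y).length + (sndP y).length ≤ _ at hl
      exact (Nat.mod_lt _ h.pos).trans ((bitsToNat_lt _).trans_le (Nat.pow_le_pow_right (by norm_num) (by omega)))
    · exact Nat.two_pow_pos _
  exact bitsOfResidues_mem_CH (3 * X + 2) (Xf := fun w => cor39Prod (bitsToNat w)) cor39Prod_val_lt hFg hFb
    fun w μ hμ => by rw [hF, sndP_boolPair, fstP_boolPair, if_pos hμ]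

/-! ### The discharges -/

/-- **Bürgisser 2009, Cor. 3.9** — PROVED: the elementary symmetric functions
`(σ_k(1, …, n))_{n, k ≤ n}` are definable in `CH`. [cite: Burgisser2006, Cor. 3.9] -/
theorem Burgisser2009_esymm_chDefinable_holds : Burgisser2009_esymm_chDefinable :=
  Burgisser2009_esymm_chDefinable_of_prodBits cor39Prod_bits_mem_CH

/-- **The coefficients of the Pochhammer–Wilkinson polynomials are definable in `CH`** — PROVED
(Bürgisser 2009, proof of Thm. 1.2 (4), via Cor. 3.9). [cite: Burgisser2009, Corollary 3.9] -/
theorem Burgisser2009_pochhammerWilkinson_coeff_chDefinable_holds : Burgisser2009_pochhammerWilkinson_coeff_chDefinable :=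
  Burgisser2009_pochhammerWilkinson_coeff_chDefinable_of_esymm Burgisser2009_esymm_chDefinable_holds

/-- **Tavenas 2014, Lemme 3.16** — PROVED: the sequence `PW_n = ∏_{i=1}^{2ⁿ} (X + i)` is
`CH/poly`-definable ("Preuve. C'est un corollaire du théorème 3.7 dans l'article de
Bürgisser [22]"). [cite: Tavenas2014, Lemma 3.16] -/
theorem Tavenas2014_pochhammerWilkinson_definable_holds : Tavenas2014_pochhammerWilkinson_definable :=
  Tavenas2014_pochhammerWilkinson_definable_of_coeff_chDefinable Burgisser2009_pochhammerWilkinson_coeff_chDefinable_holds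

end Literature.Computability.AlgebraicComplexity
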